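import Literature.Algebra.Homology.LaurentCechEvalSes
import HarnessLib

/-!
# The evaluated family is the span of the evaluated monomials; change of the base ring

For the evaluated family `evFam A θ σ e d s ⊆ 𝕜` of
`Literature/Algebra/Homology/LaurentCechEvalSes` (the image of `((L^J)_{x_s})_d` under
`evalVec θ σ`), this file records that it is the `A`-span of a set of elements of `𝕜` NOT depending on
the base ring `A` — the evaluated monomials `σ_j θ^m θ_s^{-N}` with `deg m = d - e_j + N #s`
(`LaurentCech.monoSet`, `LaurentCech.evFam_eq_span`). Consequently, for a second base ring `A'`, an
`A`-algebra acting compatibly on `𝕜` (`IsScalarTower A A' 𝕜`), the evaluated family over `A'` is the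
`A'`-span of the one over `A` (`LaurentCech.evFam_eq_span_evFam`). This is the algebraic form of
"`Γ(π⁻¹U ∩ Z_s, 𝒪(d)) = Γ(U, 𝒪_V) · Γ(Z_s, 𝒪(d))`" used to run Serre's vanishing theorem over the
rings `Γ(U, 𝒪_V)` of the affine opens of the base of a Chow cover (Görtz–Wedhorn II, Thm. 23.17).

Pure algebra; everything is proved, no named facts.

## References

* R. Hartshorne, *Algebraic Geometry*, GTM 52 (1977): II Prop. 5.11, III Thm. 5.2. [Hartshorne1977]
* U. Görtz, T. Wedhorn, *Algebraic Geometry II* (2023): Thm. 23.17, p. 424. [GortzWedhorn2023]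
-/

noncomputable section

open AddMonoidAlgebra

universe u

namespace Literature.Algebra.Homology

namespace LaurentCech

open OrderedCech

variable {M : ℕ} {𝕜 : Type u} [CommRing 𝕜] (θ : Fin (M + 1) → 𝕜) (hθ : ∀ c, IsUnit (θ c))
  {J : Type} [Fintype J] (σ : J → 𝕜) (e : J → ℤ)

/-- **The evaluated monomials** `σ_j · θ^{m - N 𝟙_s}` with `deg m = d - e_j + N #s`, `m ≥ 0`: the
generators of the evaluated family, independent of the base ring. [folklore] -/
def monoSet (d : ℤ) (s : Finset (Fin (M + 1))) : Set 𝕜 :=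
  {y | ∃ (j : J) (N : ℕ) (m : Fin (M + 1) →₀ ℕ), (m.degree : ℤ) = d - e j + N * s.card ∧
    y = σ j * (θpow θ hθ (sx M s (-(N : ℤ))) * θpow θ hθ (castExp M m))}

variable (A : Type u) [CommRing A] [Algebra A 𝕜]

omit [Fintype J] in
/-- A generator of `monoSet` as the evaluation of an explicit localized homogeneous vector.
[folklore] -/
theorem monoVec_mem_locDeg [DecidableEq J] (d : ℤ) (s : Finset (Fin (M + 1))) (j : J) (N : ℕ)
    (m : Fin (M + 1) →₀ ℕ) (hm : (m.degree : ℤ) = d - e j + N * s.card) :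
    (Pi.single j (xs A s (-(N : ℤ)) * toL A M (MvPolynomial.monomial m 1)) : J → L A M) ∈
      locDeg e (⊤ : Submodule (P A M) (J → P A M)) s d := by
  refine ⟨(mem_loc _).2 ⟨N, Pi.single j (MvPolynomial.monomial m 1), Submodule.mem_top,
    funext fun j' => ?_⟩, (mem_Kdeg e).2 fun j' => ?_⟩
  · rw [Pi.smul_apply, smul_eq_mul, ιK_apply]
    by_cases h : j' = j
    · subst h
      rw [Pi.single_eq_same, Pi.single_eq_same, ← mul_assoc, xs_mul_xs_neg, one_mul]
    · rw [Pi.single_eq_of_ne h, Pi.single_eq_of_ne h, mul_zero, map_zero]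
  · by_cases h : j' = j
    · subst h
      rw [Pi.single_eq_same]
      have h1 : toL A M (MvPolynomial.monomial m 1) ∈ Ldeg A M (m.degree : ℕ) :=
        (toL_mem_Ldeg_iff _ _).2 (MvPolynomial.isHomogeneous_monomial _ (by
          rw [Finsupp.degree_eq_weight_one]))
      have h2 := mul_mem_Ldeg (xs_mem_Ldeg (A := A) s (-(N : ℤ))) h1
      have e' : -(N : ℤ) * s.card + (m.degree : ℕ) = d - e j' := by linarith
      rwa [e'] at h2
    · rw [Pi.single_eq_of_ne h]
      exact Submodule.zero_mem _

/-- `evalVec` of the explicit vector is the evaluated monomial. [folklore] -/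
theorem evalVec_monoVec [DecidableEq J] (s : Finset (Fin (M + 1))) (j : J) (N : ℕ)
    (m : Fin (M + 1) →₀ ℕ) :
    evalVec (A := A) θ hθ σ
        (Pi.single j (xs A s (-(N : ℤ)) * toL A M (MvPolynomial.monomial m 1))) =
      σ j * (θpow θ hθ (sx M s (-(N : ℤ))) * θpow θ hθ (castExp M m)) := by
  rw [evalVec_apply, Finset.sum_eq_single j]
  · rw [Pi.single_eq_same, map_mul, xs, evalθ_single, one_smul, toL_monomial, evalθ_single,
      one_smul]
  · intro j' _ hj'
    rw [Pi.single_eq_of_ne hj', map_zero, mul_zero]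
  · intro h; exact absurd (Finset.mem_univ j) h

/-- **The evaluated family is the span of the evaluated monomials.** [folklore] -/
theorem evFam_eq_span (d : ℤ) (s : Finset (Fin (M + 1))) :
    evFam A θ hθ σ e d s = Submodule.span A (monoSet θ hθ σ e d s) := by
  classical
  refine le_antisymm ?_ (Submodule.span_le.2 ?_)
  · -- `⊆`: decompose the numerators into monomials
    rintro _ ⟨v, ⟨hloc, hdeg⟩, rfl⟩
    obtain ⟨N, F, -, hNv⟩ := (mem_loc _).1 hloc
    rw [evalVec_apply]
    refine Submodule.sum_mem _ fun j _ => ?_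
    have hvj : v j = xs A s (-(N : ℤ)) * toL A M (F j) := by
      have := congr_fun hNv j
      rw [Pi.smul_apply, smul_eq_mul, ιK_apply] at this
      rw [← this, ← mul_assoc, xs_neg_mul_xs, one_mul]
    have hFdeg : toL A M (F j) ∈ Ldeg A M (d - e j + N * s.card) := by
      have h1 : v j ∈ Ldeg A M (d - e j) := (mem_Kdeg e).1 hdeg j
      have h2 := mul_mem_Ldeg (xs_mem_Ldeg (A := A) s (N : ℤ)) h1
      have e' : xs A s (N : ℤ) * v j = toL A M (F j) := by
        have := congr_fun hNv j
        rwa [Pi.smul_apply, smul_eq_mul, ιK_apply] at this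
      rw [e'] at h2
      convert h2 using 2
      ring
    -- `toL (F j) = Σ_m coeff_m · x^m`
    have hsum : toL A M (F j) = ∑ m ∈ (F j).support,
        MvPolynomial.coeff m (F j) • toL A M (MvPolynomial.monomial m 1) := by
      conv_lhs => rw [← MvPolynomial.support_sum_monomial_coeff (F j)]
      rw [map_sum]
      refine Finset.sum_congr rfl fun m _ => ?_
      rw [← map_smul]
      congr 1
      rw [MvPolynomial.smul_monomial, smul_eq_mul, mul_one]
    rw [hvj, hsum, Finset.mul_sum, map_sum, Finset.mul_sum]
    refine Submodule.sum_mem _ fun m hm => ?_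
    have hmdeg : (m.degree : ℤ) = d - e j + N * s.card := by
      rw [mem_Ldeg] at hFdeg
      have := hFdeg (castExp M m) (by
        rw [coeff_toL_castExp]; exact MvPolynomial.mem_support_iff.1 hm)
      rw [edeg_castExp] at this
      exact this
    have hgen : σ j * (θpow θ hθ (sx M s (-(N : ℤ))) * θpow θ hθ (castExp M m)) ∈
        Submodule.span A (monoSet θ hθ σ e d s) :=
      Submodule.subset_span ⟨j, N, m, hmdeg, rfl⟩
    have e' : σ j * evalθ (A := A) θ hθ (xs A s (-(N : ℤ)) *
        MvPolynomial.coeff m (F j) • toL A M (MvPolynomial.monomial m 1)) =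
        MvPolynomial.coeff m (F j) •
          (σ j * (θpow θ hθ (sx M s (-(N : ℤ))) * θpow θ hθ (castExp M m))) := by
      rw [mul_smul_comm, map_smul, map_mul, xs, evalθ_single, one_smul, toL_monomial, evalθ_single,
        one_smul, mul_smul_comm]
    rw [e']
    exact Submodule.smul_mem _ _ hgen
  · -- `⊇`: each evaluated monomial is the evaluation of a localized homogeneous vector
    rintro _ ⟨j, N, m, hm, rfl⟩
    exact (mem_evFam A θ hθ σ e).2 ⟨_, monoVec_mem_locDeg e A d s j N m hm,
      evalVec_monoVec θ hθ σ A s j N m⟩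

/-- **Change of the base ring**: for an `A`-algebra `A'` acting compatibly on `𝕜`, the evaluated
family over `A'` is the `A'`-span of the evaluated family over `A`. [folklore] -/
theorem evFam_eq_span_evFam (A' : Type u) [CommRing A'] [Algebra A' 𝕜] [Algebra A A']
    [IsScalarTower A A' 𝕜] (d : ℤ) (s : Finset (Fin (M + 1))) :
    evFam A' θ hθ σ e d s = Submodule.span A' (evFam A θ hθ σ e d s : Set 𝕜) := by
  rw [evFam_eq_span θ hθ σ e A', evFam_eq_span θ hθ σ e A, Submodule.span_span_of_tower]

/-- Membership form of the change of base ring. [folklore] -/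
theorem mem_evFam_of_tower (A' : Type u) [CommRing A'] [Algebra A' 𝕜] [Algebra A A']
    [IsScalarTower A A' 𝕜] {d : ℤ} {s : Finset (Fin (M + 1))} {y : 𝕜}
    (hy : y ∈ evFam A θ hθ σ e d s) : y ∈ evFam A' θ hθ σ e d s := by
  rw [evFam_eq_span_evFam θ hθ σ e A A']
  exact Submodule.subset_span hy

end LaurentCech

end Literature.Algebra.Homology

end
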